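import Mathlib
import Summits.Ventures.HodgeRepro2.T6A1WeilProjector
import Summits.Ventures.HodgeRepro2.A1DescendedBijection
import Summits.Ventures.HodgeRepro2.A1DescendedSurjection
import Summits.Ventures.HodgeRepro2.A1GaloisTensorSplitting
import Summits.Ventures.HodgeRepro2.BridgePolarization

/-!
# T6A1LineHit — LINE-HIT: one algebraic split Weil class makes them all algebraic (Lemma A3.1, Prop. A3.2)

Tier-6 sub-goal A1 (route/T6-A1-t6-p1.md §1 (A1.iv), §3 layer L2). Carrier-free form of
route/T4-A1-p7.md v6 Lemma A3.1 + Prop. A3.2 for the descended Weil line `W₀ ⊆ ⋀[ℚ]^4 V`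
(`W₀ ⊗ F = ⊕_σ ⋀^4 V_σ`, p7's `eigenSummandK`; the `W_F(B)` of `T6A1WeilDescent`): a `ℚ`-subspace
`A` stable under every `[x]^* = ⋀^4(x •)` (the algebraic classes, Prop. A2.3(iii)) which meets `W₀`
non-trivially contains it. The proof is the prose's: under p7's descended bijection
`W₀ ≃ ⋀[F]^4 V` (Lemma A1.3, `restrictMap`) the operator `[x]^*` becomes multiplication by `x⁴`
(`restrictMap_T`), the `ℚ`-span of the fourth powers is all of `F` (p4's
`BridgePolarization.span_pow_four_eq_top`, the prose's step (2) of Lemma A3.1), and `⋀[F]^4 V` is an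
`F`-line when `rank_F V = 4`.
-/

namespace Summit.Ventures.HodgeRepro2.T6.A1LineHit

open A1WeilProjector
open scoped TensorProduct

variable (F : Type*) [Field F] [Algebra ℚ F]
variable (V : Type*) [AddCommGroup V] [Module ℚ V] [Module F V] [IsScalarTower ℚ F V]

/-- Under the restriction map `⋀[ℚ]^n V → ⋀[F]^n V` the pull-back `[x]^*` becomes multiplication
by `x^n` (Lemma A3.1, step (1): `[x']^*|_{W_ℂ} = Ψ(x'^4)`). -/
theorem restrictMap_T (n : ℕ) (x : F) (v : ⋀[ℚ]^n V) :
    A1DescendedSurjection.restrictMap ℚ F V n (T F V n x v) =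
      x ^ n • A1DescendedSurjection.restrictMap ℚ F V n v := by
  have h : A1DescendedSurjection.restrictMap ℚ F V n ∘ₗ T F V n x =
      (LinearMap.lsmul F (⋀[F]^n V) (x ^ n)).restrictScalars ℚ ∘ₗ
        A1DescendedSurjection.restrictMap ℚ F V n := by
    apply exteriorPower.linearMap_ext
    ext w
    simp only [LinearMap.compAlternatingMap_apply, LinearMap.comp_apply, T_apply_ιMulti,
      LinearMap.coe_restrictScalars, LinearMap.lsmul_apply, A1DescendedSurjection.restrictMap,
      exteriorPower.alternatingMapLinearEquiv_apply_ιMulti, A1ExteriorBaseChange.ιMultiRestrict_apply]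
    rw [AlternatingMap.map_smul_univ, Finset.prod_const, Finset.card_univ, Fintype.card_fin]
  exact LinearMap.congr_fun h v

variable [FiniteDimensional ℚ F] [IsGalois ℚ F] [FiniteDimensional F V]

/-- LINE-HIT (Lemma A3.1 + Prop. A3.2, carrier-free, `n = 4`): let `W₀ ⊆ ⋀[ℚ]^4 V` be the descended
Weil line (`W₀ ⊗ F = ⊕_σ ⋀^4 V_σ`) and `A ⊆ ⋀[ℚ]^4 V` a subspace stable under every `[x]^*`; if both
are `[x]^*`-stable and `A ⊓ W₀ ≠ 0` then `W₀ ≤ A`. -/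
theorem weil_le_of_inf_ne_bot {I : Type*} [LinearOrder I] (b : Module.Basis I ℚ V)
    [DecidableEq (F →ₐ[ℚ] F)] (hn : Module.finrank F V = 4)
    (W₀ : Submodule ℚ (⋀[ℚ]^4 V))
    (hW : Submodule.baseChange F W₀ = A1SplitSummandDescent.eigenSummandK ℚ F F V 4 b)
    (hW₀ : ∀ x : F, ∀ w ∈ W₀, T F V 4 x w ∈ W₀)
    (A : Submodule ℚ (⋀[ℚ]^4 V)) (hA : ∀ x : F, ∀ v ∈ A, T F V 4 x v ∈ A)
    (hne : A ⊓ W₀ ≠ ⊥) : W₀ ≤ A := by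
  obtain ⟨W₁, hW₁, hbij⟩ := A1DescendedBijection.exists_descended_bijective ℚ F F V 4 b
    (A1GaloisTensorSplitting.card_algHom_self ℚ F)
  have hWW : W₁ = W₀ := A1BaseChange.baseChange_injective (K := F) (hW₁.trans hW.symm)
  subst hWW
  set r := A1DescendedSurjection.restrictMap ℚ F V 4 with hr
  have hinj : ∀ u u' : ⋀[ℚ]^4 V, u ∈ W₁ → u' ∈ W₁ → r u = r u' → u = u' := by
    intro u u' hu hu' h
    have : (r ∘ₗ W₁.subtype) ⟨u, hu⟩ = (r ∘ₗ W₁.subtype) ⟨u', hu'⟩ := by simpa using h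
    exact congrArg Subtype.val (hbij.1 this)
  obtain ⟨w, hw, hw0⟩ := (Submodule.ne_bot_iff _).1 hne
  have ha0 : r w ≠ 0 := by
    intro h
    exact hw0 (hinj w 0 hw.2 (zero_mem _) (by rw [h, map_zero]))
  have hdim : Module.finrank F (⋀[F]^4 V) = 1 := by
    rw [exteriorPower.finrank_eq, hn, Nat.choose_self]
  have hspan := (finrank_eq_one_iff_of_nonzero' _ ha0).1 hdim
  have key : ∀ y ∈ Submodule.span ℚ (Set.range fun x : F => x ^ 4),
      ∃ u ∈ A ⊓ W₁, r u = y • r w := by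
    intro y hy
    induction hy using Submodule.span_induction with
    | mem y hy =>
      obtain ⟨x, rfl⟩ := hy
      exact ⟨T F V 4 x w, ⟨hA x w hw.1, hW₀ x w hw.2⟩, restrictMap_T F V 4 x w⟩
    | zero => exact ⟨0, zero_mem _, by rw [map_zero, zero_smul]⟩
    | add y z _ _ hy hz =>
      obtain ⟨u, hu, hu'⟩ := hy
      obtain ⟨u', hu'', hu'''⟩ := hz
      exact ⟨u + u', add_mem hu hu'', by rw [map_add, hu', hu''', add_smul]⟩
    | smul q y _ hy =>
      obtain ⟨u, hu, hu'⟩ := hy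
      exact ⟨q • u, Submodule.smul_mem _ q hu, by rw [map_smul, hu', smul_assoc]⟩
  intro w' hw'
  obtain ⟨y, hy⟩ := hspan (r w')
  obtain ⟨u, hu, hu'⟩ := key y (by rw [BridgePolarization.span_pow_four_eq_top]; exact Submodule.mem_top)
  have : w' = u := hinj w' u hw' hu.2 (by rw [← hy, hu'])
  rw [this]
  exact hu.1

end Summit.Ventures.HodgeRepro2.T6.A1LineHit
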